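import Literature.AlgebraicGeometry.Resolution.AlterationsPreSemiStable
import HarnessLib

/-!
# De Jong's alteration theorem: 4.15–4.22a split at 4.16 — `Z` a union of sections, (vi) f)

Topic: `Literature/AlgebraicGeometry/Resolution`. Companion to `AlterationsPreSemiStable.lean`,
which vendors de Jong 1996, 4.15–4.21 with the first half of 4.22 — from a fibred pair `(X, Z)`
with (i), (iii), (iv), (vi) a)–e) (`DeJong1996.FibredPair f g Z`, `DeJong1996.HasThreeSmoothPoints f Z`)
to the pointed semi-stable curve `(𝒞, τ₁(Y) ∪ … ∪ τₙ(Y) ∪ f⁻¹(D))`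
(`DeJong1996.PreSemiStablePair`) — as ONE named fact `DeJong1996MultisectionToPreSemiStablePair`.
This file cuts it after 4.16, where the text reaches

> "4.16. Assume (i)–(iv), (vi) a)–e). Let `Z = ⋃ᵢ₌₁ⁿ Zᵢ` be the decomposition into irreducible
> components of `Z`. Choose a finite separable Galois extension `k(Y) ⊂ L` such that `k(Zᵢ)`
> may be embedded over `k(Y)` into `L` for all `i`; this is possible as the field extensions
> `k(Y) ⊂ k(Zᵢ)` are finite separable by (vi) d). Let `Y'` be the normalization of `Y` in the
> field `L`, then `ψ : Y' → Y` is a (finite) generically étale alteration of `Y`. Constructing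
> `(X', Z')` as in 4.15, we see that `Z' = Z'₁ ∪ … ∪ Z'ₙ` with `Z'ᵢ → Y'` finite and
> birational. (Any component of `Z'` dominates `Y'` as `Z'` has pure codimension 1 in `X'` in
> view of (iv).) Thus `Z'ᵢ → Y'` is an isomorphism as `Y'` is normal. It follows that we may
> assume the following property in addition to (i)–(iv), (vi) a)–e):
> (vi) f) There are sections `σᵢ : Y → X`, `i = 1, …, n` of `f` such that `Z = ⋃ σᵢ(Y)`.
> We note that (vi) f) is also preserved by alterations as in 4.15." (p. 71)

Accordingly this file

* defines property **(vi) f)**, `DeJong1996.IsUnionOfSections f Z`: there are finitely many,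
  pairwise distinct sections `σ₁, …, σₙ` of `f` (`σᵢ ≫ f = 𝟙`; distinct because the `σᵢ(Y)`
  are the distinct irreducible components `Zᵢ` of `Z` in 4.16 — and 4.17 needs
  `U = {y | σᵢ(y) ≠ σⱼ(y), i ≠ j} ≠ ∅`) with `Z = ⋃ᵢ σᵢ(Y)`; proved API: each `σᵢ(Y)` is closed
  when `f` is separated, and `Z` is then closed;
* vendors NAMED FACTS `DeJong1996SectionsReduction` (**4.15–4.16**: Thm. 4.1 with its
  generically-étale clause for a fibred pair with (vi) e) follows from the same for all fibred
  pairs with (vi) e) AND (vi) f) over `k` of the same dimension — Galois normalisation of the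
  base, the strict transform 4.15, and 4.4) and `DeJong1996SectionsToPreSemiStablePair`
  (**4.17–4.21 and 4.22 up to the induction hypothesis**: Thm. 4.1 with the clause for a fibred
  pair with (vi) e), f) follows from the same for all pre-semi-stable pairs over `k` of the same
  dimension — the projective level-`ℓ` moduli scheme of stable `n`-pointed curves 4.17/2.24,
  flattening 2.19 and the three-point Lemma 4.18–4.21, and the replacement of `X` by `𝒞` in
  4.22 by 4.4 and 4.9);
* PROVES the assembly `DeJong1996MultisectionToPreSemiStablePair.of_sections_of_toPre`, its
  composites down to `DeJong1996NormalProjectiveStepVI`, `DeJong1996StrongAlgClosed` and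
  `DeJong1996Strong`, and the sanity implications from `DeJong1996StrongAlgClosed` to each new
  fact.

`DeJong1996SectionsToPreSemiStablePair` is the node to decompose further (4.17: (vi) g), which
needs stable `n`-pointed curves, 2.24/[16]; 4.18–4.21: the three-point lemma in the general
setting of 4.18; 4.22 first half); `DeJong1996SectionsReduction` should follow from the
normalisation of `Y` in a finite extension of its function field (`normalizationIn`,
`NormalizationInExtension.lean`), the strict transform 2.18 and Zariski's main theorem in the
form "finite birational onto a normal scheme is an isomorphism". The owning literature unit's
`NOTES.md` keeps the DAG.

## Sources

* A. J. de Jong, *Smoothness, semi-stability and alterations*, Publ. Math. IHÉS 83 (1996) 51–93: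
  2.18, 2.20, 2.24 (pp. 60–62), Thm. 4.1, 4.4, 4.9 (pp. 66–67), 4.15–4.17 (pp. 71–72),
  4.18–4.22 (pp. 72–75).
-/

noncomputable section

open CategoryTheory CategoryTheory.Limits AlgebraicGeometry TopologicalSpace Topology

namespace Literature.AlgebraicGeometry.Resolution

universe u

namespace DeJong1996

/-! ## Property (vi) f) -/

/-- **de Jong 1996, 4.16 (vi) f)** for a morphism `f : X → Y` and a subset `Z ⊆ X`: "There are
sections `σᵢ : Y → X`, `i = 1, …, n` of `f` such that `Z = ⋃ σᵢ(Y)`." Rendered: there are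
`n : ℕ` and pairwise distinct sections `σ : Fin n → (Y ⟶ X)` of `f` (`σᵢ ≫ f = 𝟙 Y`; in 4.16 the
`σᵢ(Y) = Zᵢ` are the distinct irreducible components of `Z`, and 4.17 uses that the open
`U = {y ∈ Y | σᵢ(y) ≠ σⱼ(y) for i ≠ j}` is non-empty) whose images cover `Z` exactly:
`Z = ⋃ᵢ σᵢ(Y)` as sets. [cite: DeJong1996, 4.16 (vi) f), p. 71] -/
def IsUnionOfSections {X Y : Scheme.{u}} (f : X ⟶ Y) (Z : Set X) : Prop :=
  ∃ (n : ℕ) (σ : Fin n → (Y ⟶ X)), Function.Injective σ ∧ (∀ i, σ i ≫ f = 𝟙 Y) ∧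
    Z = ⋃ i, Set.range (σ i)

namespace IsUnionOfSections

variable {X Y : Scheme.{u}} {f : X ⟶ Y} {Z : Set X}

/-- A section of a separated morphism is a closed immersion. [folklore] -/
theorem isClosedImmersion_of_comp_eq_id [IsSeparated f] {σ : Y ⟶ X} (hσ : σ ≫ f = 𝟙 Y) :
    IsClosedImmersion σ :=
  haveI : IsClosedImmersion (σ ≫ f) := by rw [hσ]; infer_instance
  .of_comp σ f

/-- A union of finitely many sections of a separated morphism is closed. [folklore] -/
theorem isClosed [IsSeparated f] (h : IsUnionOfSections f Z) : IsClosed Z := by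
  obtain ⟨n, σ, -, hσ, rfl⟩ := h
  refine isClosed_iUnion_of_finite fun i => ?_
  haveI := isClosedImmersion_of_comp_eq_id (hσ i)
  exact (σ i).isClosedEmbedding.isClosed_range

/-- With `Z = ⋃ᵢ σᵢ(Y)`, the sections land in `Z`. [folklore] -/
theorem range_subset (h : IsUnionOfSections f Z) :
    ∃ (n : ℕ) (σ : Fin n → (Y ⟶ X)), (∀ i, σ i ≫ f = 𝟙 Y) ∧ ∀ i, Set.range (σ i) ⊆ Z := by
  obtain ⟨n, σ, -, hσ, rfl⟩ := h
  exact ⟨n, σ, hσ, fun i => Set.subset_iUnion (fun i => Set.range (σ i)) i⟩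

/-- `f` is surjective on `Z = ⋃ᵢ σᵢ(Y)` as soon as `n ≥ 1`; in any case `f '' Z ⊆ Y` is all of
`Y` or `Z` is empty. Recorded in the weak form: every point of `Z` maps to a point over which
`Z` has a point. [folklore] -/
theorem exists_mem_of_mem (h : IsUnionOfSections f Z) {x : X} (hx : x ∈ Z) (y : Y) :
    ∃ x' ∈ Z, f x' = y := by
  obtain ⟨n, σ, -, hσ, rfl⟩ := h
  obtain ⟨i, -⟩ := Set.mem_iUnion.mp hx
  refine ⟨σ i y, Set.mem_iUnion.mpr ⟨i, ⟨y, rfl⟩⟩, ?_⟩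
  rw [← Scheme.Hom.comp_apply, hσ i]
  rfl

end IsUnionOfSections

end DeJong1996

/-! ## 4.15–4.16 and 4.17–4.22a as named facts -/

/-- NAMED FACT — **de Jong 1996, 4.15–4.16: making `Z` a union of sections by a Galois
normalisation of the base.** Over an algebraically closed field `k`, let `(X, Z)` with
`f : X → Y → Spec k` satisfy (i), (iii), (iv), (vi) a)–d) (`DeJong1996.FibredPair f g Z`) and
(vi) e) (`DeJong1996.HasThreeSmoothPoints f Z`). Then Thm. 4.1 with its generically-étale clause
for `(X → Spec k, Z)` follows from Thm. 4.1 with the clause for every such pair `(X', Z')` with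
`f' : X' → Y' → Spec k` over `k` which moreover has (vi) f) (`DeJong1996.IsUnionOfSections f' Z'`:
`Z' = ⋃ σᵢ(Y')` for pairwise distinct sections `σᵢ` of `f'`) and `dim X' = dim X`: "4.15. […]
we will consider projective alterations `ψ : Y' → Y`, which are generically étale. […] Here
`X'` is the reduction of the scheme `Y' ×_Y X`, i.e. `f'` is the strict transform of `f` with
respect to the alteration `ψ`, cf. 2.20 and 2.18. Put `Z' = pr₂⁻¹(Z)_red` […] the morphism `f'`
satisfies (vi) a)–c); from this we conclude that `X'` is irreducible. Thus `φ : X' → X` is a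
projective alteration which is generically étale. Conditions (i), (iii) and (iv) are all right
for the pair `(X', Z')`, but (v) may fail […]. Finally, (vi) d) is trivial to verify for
`f'|_{Z'}` and (vi) e) holds since `φ⁻¹(sm(X/Y)) ⊂ sm(X'/Y')`. As before it is clear that it
suffices to prove the theorem for the pair `(X', Z')` [4.4]. 4.16. […] Let `Y'` be the
normalization of `Y` in the field `L` [a finite Galois extension of `k(Y)` containing all
`k(Zᵢ)`, finite separable over `k(Y)` by (vi) d)], then `ψ : Y' → Y` is a (finite) generically
étale alteration of `Y`. Constructing `(X', Z')` as in 4.15, we see that `Z' = Z'₁ ∪ … ∪ Z'ₙ`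
with `Z'ᵢ → Y'` finite and birational. […] Thus `Z'ᵢ → Y'` is an isomorphism as `Y'` is normal.
It follows that we may assume […] (vi) f)". The replacement is along the generically étale
alteration `φ` (4.4, `DeJong1996.ConclusionGenericallyEtale.of_isAlteration`), which preserves
`dim X` (2.20, `IsAlteration.topologicalKrullDim_eq`). Users take
`(h : DeJong1996SectionsReduction)`. [cite: DeJong1996, 4.15–4.16, p. 71] -/
def DeJong1996SectionsReduction : Prop :=
  ∀ (k : Type u) [Field k] [IsAlgClosed k] (X Y : Scheme.{u}) [IsIntegral Y] (f : X ⟶ Y)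
    [LocallyOfFinitePresentation f] (g : Y ⟶ Spec (.of k)) (Z : Set X),
    DeJong1996.FibredPair f g Z → DeJong1996.HasThreeSmoothPoints f Z →
      (∀ (X' Y' : Scheme.{u}) [IsIntegral Y'] (f' : X' ⟶ Y') [LocallyOfFinitePresentation f']
          (g' : Y' ⟶ Spec (.of k)) (Z' : Set X'),
          DeJong1996.FibredPair f' g' Z' → DeJong1996.HasThreeSmoothPoints f' Z' →
            DeJong1996.IsUnionOfSections f' Z' → topologicalKrullDim X' = topologicalKrullDim X →
              DeJong1996.ConclusionGenericallyEtale (f' ≫ g') Z') →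
        DeJong1996.ConclusionGenericallyEtale (f ≫ g) Z

/-- NAMED FACT — **de Jong 1996, 4.17–4.21 and 4.22 up to the induction hypothesis: from `Z` a
union of sections to the pointed semi-stable curve `(𝒞, τ₁(Y) ∪ … ∪ τₙ(Y) ∪ f⁻¹(D))`.** Over an
algebraically closed field `k`, let `(X, Z)` with `f : X → Y → Spec k` satisfy (i), (iii), (iv),
(vi) a)–d) (`DeJong1996.FibredPair f g Z`), (vi) e) (`DeJong1996.HasThreeSmoothPoints f Z`) and
(vi) f) (`DeJong1996.IsUnionOfSections f Z`). Then Thm. 4.1 with its generically-étale clause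
for `(X → Spec k, Z)` follows from Thm. 4.1 with the clause for every pre-semi-stable pair over
`k` (`DeJong1996.PreSemiStablePair f' g' D' τ`, boundary `⋃ᵢ τᵢ(Y') ∪ f'⁻¹(D')`) of the same
dimension as `X`. This is the content of 4.17 ("`U = {y ∈ Y | X_y` is smooth over `y` and
`σᵢ(y) ≠ σⱼ(y)` for `i ≠ j}`. By (vi) c) we have `U ≠ ∅`. […] In view of (vi) e) we have
`n ≥ 3` […], hence `(X_U, σ₁|_U, …, σₙ|_U)` is a stable `n`-pointed curve of genus `g` over
`U`. […] Choose `ℓ ≥ 3` prime to the characteristic of `k`. Let `U' ⊂ U ×_{M_{g,n}} ℓM_{g,n}`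
be an irreducible component […] Put `Y'` equal to the closure of
`Im(U' → Y ×_k ℓM̄_{g,n})` […] `Y'` is a projective variety over `k` and `ψ : Y' → Y` is an
alteration which is generically étale. The smooth stable `n`-pointed curve […] extends to a
stable `n`-pointed curve over `Y'`, see 2.24. […] Replacing `Y` by `Y'` and `X` by `X'` as in
4.15 we reduce to a case in which (i)–(iv), (vi) a)–f) hold and (vi) g) There exist a stable
`n`-pointed curve `(𝒞, τ₁, …, τₙ)` over `Y`, a nonempty open subscheme `U ⊂ Y` and an
isomorphism `β : 𝒞_U → X_U` mapping the section `τᵢ|_U` to the section `σᵢ|_U`"), 4.18–4.21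
(flattening 2.19 of `X` and of the closure `T` of `Γ_β`, normalisation of the base, the
three-point Lemma 4.20 and Serre's criterion: "the rational map `β` extends to a birational
morphism `β : 𝒞 → X`, at least after replacing `S` by a modification and `𝒞` and `X` by their
strict transforms"), and 4.22 up to "At this point" ("Thus there is a closed subset `D ⊂ Y` such
that we have `β⁻¹(Z) ⊂ τ₁(Y) ∪ … ∪ τₙ(Y) ∪ f⁻¹(D)` and such that `𝒞 → Y` is smooth over
`Y ∖ D`. We replace `X` by `𝒞` and `Z` by `τ₁(Y) ∪ … ∪ τₙ(Y) ∪ f⁻¹(D)`, see 4.4 and 4.9.").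
Every replacement of `(X, Z)` is an enlargement of `Z` (4.9) or is along a generically étale
alteration (4.4; the modification `β` included), which preserves `dim X` (2.20). Users take
`(h : DeJong1996SectionsToPreSemiStablePair)`; it is the node to decompose further (4.17: stable
`n`-pointed curves and their projective level-`ℓ` moduli scheme, 2.24; 4.18–4.21: the
three-point lemma). [cite: DeJong1996, 4.17–4.22, pp. 71–74] -/
def DeJong1996SectionsToPreSemiStablePair : Prop :=
  ∀ (k : Type u) [Field k] [IsAlgClosed k] (X Y : Scheme.{u}) [IsIntegral Y] (f : X ⟶ Y)
    [LocallyOfFinitePresentation f] (g : Y ⟶ Spec (.of k)) (Z : Set X),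
    DeJong1996.FibredPair f g Z → DeJong1996.HasThreeSmoothPoints f Z →
      DeJong1996.IsUnionOfSections f Z →
        (∀ (X' Y' : Scheme.{u}) (f' : X' ⟶ Y') (g' : Y' ⟶ Spec (.of k)) (D' : Set Y') (n : ℕ)
            (τ : Fin n → (Y' ⟶ X')), DeJong1996.PreSemiStablePair f' g' D' τ →
            topologicalKrullDim X' = topologicalKrullDim X →
              DeJong1996.ConclusionGenericallyEtale (f' ≫ g')
                (DeJong1996.semiStableBoundary f' D' τ)) →
          DeJong1996.ConclusionGenericallyEtale (f ≫ g) Z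

/-! ## The assembly -/

/-- **4.15–4.22a from its two parts**: first 4.15–4.16 (`DeJong1996SectionsReduction`), then, for
each fibred pair with (vi) e), f) of dimension `dim X` so produced, 4.17–4.22a
(`DeJong1996SectionsToPreSemiStablePair`). [cite: DeJong1996, 4.15–4.22, pp. 71–74] -/
theorem DeJong1996MultisectionToPreSemiStablePair.of_sections_of_toPre
    (h₁ : DeJong1996SectionsReduction.{u}) (h₂ : DeJong1996SectionsToPreSemiStablePair.{u}) :
    DeJong1996MultisectionToPreSemiStablePair.{u} := by
  intro k _ _ X Y _ f _ g Z hP h3 hS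
  refine h₁ k X Y f g Z hP h3 ?_
  intro X' Y' _ f' _ g' Z' hP' h3' hf' hdim'
  refine h₂ k X' Y' f' g' Z' hP' h3' hf' ?_
  intro X'' Y'' f'' g'' D'' n τ hpre hdim''
  exact hS X'' Y'' f'' g'' D'' n τ hpre (hdim''.trans hdim')

/-- **4.15–4.22 (`DeJong1996MultisectionToSemiStablePair`) from 4.15–4.16, 4.17–4.22a and 4.22b.**
[cite: DeJong1996, 4.15–4.22, pp. 71–75] -/
theorem DeJong1996MultisectionToSemiStablePair.of_sections_of_toPre_of_preToSemiStable
    (h₁ : DeJong1996SectionsReduction.{u}) (h₂ : DeJong1996SectionsToPreSemiStablePair.{u})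
    (h₃ : DeJong1996PreSemiStablePairToSemiStablePair.{u}) :
    DeJong1996MultisectionToSemiStablePair.{u} :=
  DeJong1996MultisectionToSemiStablePair.of_toPre_of_preToSemiStable
    (DeJong1996MultisectionToPreSemiStablePair.of_sections_of_toPre h₁ h₂) h₃

/-- **`DeJong1996NormalProjectiveStepVI` (4.13–4.28) from five named inputs**: 4.14, 4.15–4.16,
4.17–4.22a, 4.22b and 4.23–4.28. [cite: DeJong1996, 4.13–4.28, pp. 69–76] -/
theorem DeJong1996NormalProjectiveStepVI.of_multisection_of_sections_of_toPre_of_preToSemiStable_of_resolution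
    (h14 : DeJong1996MultisectionReduction.{u}) (h₁ : DeJong1996SectionsReduction.{u})
    (h₂ : DeJong1996SectionsToPreSemiStablePair.{u})
    (h₃ : DeJong1996PreSemiStablePairToSemiStablePair.{u})
    (hres : DeJong1996SemiStablePairResolution.{u}) : DeJong1996NormalProjectiveStepVI.{u} :=
  DeJong1996NormalProjectiveStepVI.of_multisection_of_toPre_of_preToSemiStable_of_resolution h14
    (DeJong1996MultisectionToPreSemiStablePair.of_sections_of_toPre h₁ h₂) h₃ hres

/-- Sanity of the cut: `DeJong1996SectionsReduction` is a special case of Thm. 4.1 over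
algebraically closed fields (a fibred pair is a pair as in Thm. 4.1). [folklore] -/
theorem DeJong1996SectionsReduction.of_strongAlgClosed (H : DeJong1996StrongAlgClosed.{u}) :
    DeJong1996SectionsReduction.{u} :=
  fun _ _ _ _ _ _ _ _ _ _ hP _ _ => hP.conclusionGenericallyEtale_of_strongAlgClosed H

/-- Sanity of the cut: `DeJong1996SectionsToPreSemiStablePair` is a special case of Thm. 4.1 over
algebraically closed fields. [folklore] -/
theorem DeJong1996SectionsToPreSemiStablePair.of_strongAlgClosed
    (H : DeJong1996StrongAlgClosed.{u}) : DeJong1996SectionsToPreSemiStablePair.{u} :=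
  fun _ _ _ _ _ _ _ _ _ _ hP _ _ _ => hP.conclusionGenericallyEtale_of_strongAlgClosed H

/-- The induction step 4.6–4.28 (`DeJong1996InductionStep`) from the six live nodes 4.11–4.12,
4.14, 4.15–4.16, 4.17–4.22a, 4.22b, 4.23–4.28. [cite: DeJong1996, 4.6–4.28, pp. 66–76] -/
theorem DeJong1996InductionStep.of_sixBlocks (h₀ : DeJong1996FibrationReduction.{u})
    (h14 : DeJong1996MultisectionReduction.{u}) (h₁ : DeJong1996SectionsReduction.{u})
    (h₂ : DeJong1996SectionsToPreSemiStablePair.{u})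
    (h₃ : DeJong1996PreSemiStablePairToSemiStablePair.{u})
    (hres : DeJong1996SemiStablePairResolution.{u}) : DeJong1996InductionStep.{u} :=
  DeJong1996InductionStep.of_fiveBlocks h₀ h14
    (DeJong1996MultisectionToPreSemiStablePair.of_sections_of_toPre h₁ h₂) h₃ hres

/-- **Thm. 4.1 with its generically-étale clause over algebraically closed fields
(`DeJong1996StrongAlgClosed`) from the six live nodes** 4.11–4.12, 4.14, 4.15–4.16, 4.17–4.22a,
4.22b, 4.23–4.28. [cite: DeJong1996, 4.3–4.28, pp. 66–76] -/
theorem DeJong1996StrongAlgClosed.of_sixBlocks (h₀ : DeJong1996FibrationReduction.{u})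
    (h14 : DeJong1996MultisectionReduction.{u}) (h₁ : DeJong1996SectionsReduction.{u})
    (h₂ : DeJong1996SectionsToPreSemiStablePair.{u})
    (h₃ : DeJong1996PreSemiStablePairToSemiStablePair.{u})
    (hres : DeJong1996SemiStablePairResolution.{u}) : DeJong1996StrongAlgClosed.{u} :=
  DeJong1996StrongAlgClosed.of_fiveBlocks h₀ h14
    (DeJong1996MultisectionToPreSemiStablePair.of_sections_of_toPre h₁ h₂) h₃ hres

/-- Thm. 4.1 (i)+(ii) and its last sentence from the limit argument of 4.5
(`DeJong1996.FiniteSubextension45`) and the six live nodes. [cite: DeJong1996, Thm. 4.1, p. 66] -/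
theorem DeJong1996Strong.of_finiteSubextension45_of_sixBlocks
    (H : DeJong1996.FiniteSubextension45.{u}) (h₀ : DeJong1996FibrationReduction.{u})
    (h14 : DeJong1996MultisectionReduction.{u}) (h₁ : DeJong1996SectionsReduction.{u})
    (h₂ : DeJong1996SectionsToPreSemiStablePair.{u})
    (h₃ : DeJong1996PreSemiStablePairToSemiStablePair.{u})
    (hres : DeJong1996SemiStablePairResolution.{u}) :
    DeJong1996Strong.{u} ∧ DeJong1996StrongPerfect.{u} :=
  DeJong1996Strong.of_finiteSubextension45_of_fiveBlocks H h₀ h14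
    (DeJong1996MultisectionToPreSemiStablePair.of_sections_of_toPre h₁ h₂) h₃ hres

/-- Thm. 4.1 (i)+(ii) over every field from 4.5 (`DeJong1996Descent`) and the six live nodes.
[cite: DeJong1996, 4.3–4.28, pp. 66–76] -/
theorem DeJong1996Strong.of_descent_of_sixBlocks (h45 : DeJong1996Descent.{u})
    (h₀ : DeJong1996FibrationReduction.{u}) (h14 : DeJong1996MultisectionReduction.{u})
    (h₁ : DeJong1996SectionsReduction.{u}) (h₂ : DeJong1996SectionsToPreSemiStablePair.{u})
    (h₃ : DeJong1996PreSemiStablePairToSemiStablePair.{u})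
    (hres : DeJong1996SemiStablePairResolution.{u}) : DeJong1996Strong.{u} :=
  DeJong1996Strong.of_descent_of_fiveBlocks h45 h₀ h14
    (DeJong1996MultisectionToPreSemiStablePair.of_sections_of_toPre h₁ h₂) h₃ hres

end Literature.AlgebraicGeometry.Resolution

end
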